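import Summits.Langlands.Langlands.Theorems.IrreducibilityBySelfDualityReciprocityUpToIrreducibilityRStringCounting
import Summits.Langlands.Langlands.Theorems.IrreducibilityBySelfDualityReciprocityUpToIrreducibilityRGluing
import Summits.Langlands.Langlands.Theorems.IrreducibilityBySelfDualityReciprocityUpToIrreducibilityRStringIso
import Summits.Langlands.Langlands.Theorems.IrreducibilityBySelfDualityReciprocityUpToIrreducibilityRIrreducibleEulerTrivial
import HarnessLib

/-!
# Henniart 2002, Thm 1.7 (a), Galois side — reconstruction from `Hom`-counts, part 1 (toward stub S-17a-B
# of line `Sketch`, crux stmt-Langlands-17925 `IrreducibilityBySelfDuality.ReciprocityUpToIrreducibilityR`)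

**Reconstruction** (`isEquivalent_ofSubrep_of_K_eq`): two sub-Weil–Deligne representations `U ≤ σ`,
`U' ≤ σ'` of Frobenius-semisimple `σ, σ'` with the same `Hom`-counts
`K_U(ρ, d) = dim Hom_WD(ρ ⊗ Sp(d), σ; U)` against every standard string are isomorphic: peel off a string
summand `string(H, e)` of `U`; the count `c_{U'}(ρ_H, e) = c_U(ρ_H, e) ≥ 1` locates a matching string
summand of `U'` (`…RStringCounting`); the complements have the same counts, induction, and gluing
(`…RStringIso`, `…RGluing`).  Then the registered stub `stub_isEquivalent_of_finrank_invariants_tprod_eq`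
(Henniart, Bull. SMF 130 (2002), Thm 1.7 (a) in invariant form): the hypothesis gives equal counts for
ADMISSIBLE probes (`dim ρ ⊗ Sp(d) < n`; `…RInvariantsHomDual`, `…RDualProbes`, `…RProbeModel`); if both
`σ, σ'` are decomposable every string has dimension `≤ n - 1` and the counts stabilise beyond the
admissible range (`K_stable`), so reconstruction applies; if one of them is a single string `ρ_H ⊗ Sp(e)`
(`e ≥ 2` on the `σ`-side, as `σ` is not irreducible), the socle probe `ρ_H ⊗ ‖·‖^{e-1}` of dimension
`< n` forces the other to be the same string (and rules out the decomposable / irreducible alternatives).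
No definitions; standard axioms only.
-/

noncomputable section

set_option linter.dupNamespace false

open Module
open Literature.NumberTheory.Automorphic Literature.NumberTheory.GaloisRepresentations
open Literature.NumberTheory.GaloisRepresentations.WeilGroup
open Literature.NumberTheory.GaloisRepresentations.IsNonarchimedeanLocalField

namespace Summit.Langlands.Langlands.Theorems.ReciprocityUpToIrreducibilityR

variable {F : Type} [Field F] [ValuativeRel F] [TopologicalSpace F] [IsNonarchimedeanLocalField F]

/-! ## Small lemmas -/

section Small

variable {V : Type} [AddCommGroup V] [Module ℂ V] [FiniteDimensional ℂ V]
variable {V' : Type} [AddCommGroup V'] [Module ℂ V'] [FiniteDimensional ℂ V']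
variable {Hp : Type} [AddCommGroup Hp] [Module ℂ Hp] [FiniteDimensional ℂ Hp]

omit [FiniteDimensional ℂ Hp] in
/-- `IsoTw ρ₁ 0 ρ₂` lets one replace `ρ₁` by `ρ₂` on the left of `IsoTw`. [folklore] -/
theorem isoTw_congr_left {H₁ H₂ : Type*} [AddCommGroup H₁] [Module ℂ H₁] [AddCommGroup H₂] [Module ℂ H₂]
    {ρ₁ : Representation ℂ (WeilGroup F) H₁} {ρ₂ : Representation ℂ (WeilGroup F) H₂}
    (h : IsoTw ρ₁ 0 ρ₂) (ρ : Representation ℂ (WeilGroup F) Hp) (i : ℤ) : IsoTw ρ₁ i ρ ↔ IsoTw ρ₂ i ρ := by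
  constructor
  · intro h1
    have := h.symm.trans h1
    rwa [neg_zero, zero_add] at this
  · intro h2
    have := h.trans h2
    rwa [zero_add] at this

/-- From `IsoTw ρ₁ 0 ρ₂` an isomorphism `ρ₂ ≅ ρ₁`. [folklore] -/
theorem nonempty_equiv_of_isoTw_zero {H₁ H₂ : Type*} [AddCommGroup H₁] [Module ℂ H₁] [AddCommGroup H₂]
    [Module ℂ H₂] {ρ₁ : Representation ℂ (WeilGroup F) H₁} {ρ₂ : Representation ℂ (WeilGroup F) H₂}
    (h : IsoTw ρ₁ 0 ρ₂) : Nonempty (ρ₂.Equiv ρ₁) := by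
  obtain ⟨e⟩ := h
  rw [twistRep_zero] at e
  exact ⟨e.symm⟩

omit [FiniteDimensional ℂ V] [FiniteDimensional ℂ V'] in
/-- Weil–Deligne representations on zero subspaces are isomorphic. [folklore] -/
theorem isEquivalent_ofSubrep_bot (σ : WeilDeligneRep F ℂ V) (σ' : WeilDeligneRep F ℂ V')
    (h : σ.IsSubrep ⊥) (h' : σ'.IsSubrep ⊥) : (σ.ofSubrep ⊥ h).IsEquivalent (σ'.ofSubrep ⊥ h') :=
  ⟨{ toRepEquiv := Representation.Equiv.mk (LinearEquiv.ofSubsingleton _ _)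
      fun _ => LinearMap.ext fun _ => Subsingleton.elim _ _
     comm_N := LinearMap.ext fun _ => Subsingleton.elim _ _ }⟩

omit [FiniteDimensional ℂ V] in
/-- `Hom_WD(τ, σ; ⊤) = Hom_WD(τ, σ)`. [folklore] -/
theorem homWDIn_top {W : Type*} [AddCommGroup W] [Module ℂ W] (τ : WeilDeligneRep F ℂ W)
    (σ : WeilDeligneRep F ℂ V) : homWDIn τ σ ⊤ = homWD τ σ := by
  ext f
  exact ⟨fun hf => hf.1, fun hf => ⟨hf, fun _ => trivial⟩⟩

omit [FiniteDimensional ℂ Hp] in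
/-- The count against the empty string vanishes: `K_U(ρ, 0) = 0`. [folklore] -/
theorem K_len_zero (ρ : Representation ℂ (WeilGroup F) Hp) (hρ : WeilGroup.IsContinuousRep ρ)
    (σ : WeilDeligneRep F ℂ V) (U : Submodule ℂ V) : finrank ℂ (homWDIn (stringModel ρ hρ 0) σ U) = 0 := by
  haveI : Subsingleton ((Fin 0 → Hp) →ₗ[ℂ] V) :=
    ⟨fun f g => LinearMap.ext fun y => by rw [Subsingleton.elim y 0, map_zero, map_zero]⟩
  exact le_antisymm ((Submodule.finrank_le _).trans (Module.finrank_zero_of_subsingleton).le) (Nat.zero_le _)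

/-- `dim (Fin d → H) = d · dim H`. [folklore] -/
theorem finrank_fin_fun' (d : ℕ) : finrank ℂ (Fin d → Hp) = d * finrank ℂ Hp := by
  rw [Module.finrank_pi_fintype, Finset.sum_const, Finset.card_univ, Fintype.card_fin, smul_eq_mul]

end Small

/-! ## Reconstruction from the counts -/

section Reconstruction

variable {V : Type} [AddCommGroup V] [Module ℂ V] [FiniteDimensional ℂ V]
variable {V' : Type} [AddCommGroup V'] [Module ℂ V'] [FiniteDimensional ℂ V']

/-- **Reconstruction.**  Sub-Weil–Deligne representations `U ≤ σ`, `U' ≤ σ'` (`σ, σ'`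
Frobenius-semisimple) with the same counts `K_U(ρ, d) = K_{U'}(ρ, d)` against every standard string
`ρ ⊗ Sp(d)` (`ρ` continuous irreducible with semisimple `ρ(w)`, on a non-zero finite-dimensional space)
are isomorphic. [cite: HenniartBSMF2002, Thm. 1.7 (a)] -/
theorem isEquivalent_ofSubrep_of_K_eq {σ : WeilDeligneRep F ℂ V} {σ' : WeilDeligneRep F ℂ V'}
    (hσ : σ.IsFrobSemisimple) (hσ' : σ'.IsFrobSemisimple) :
    ∀ (m : ℕ) (U : Submodule ℂ V) (U' : Submodule ℂ V') (hU : σ.IsSubrep U) (hU' : σ'.IsSubrep U'),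
      finrank ℂ U = m →
      (∀ (Hp : Type) [AddCommGroup Hp] [Module ℂ Hp] [FiniteDimensional ℂ Hp] [Nontrivial Hp]
        (ρ : Representation ℂ (WeilGroup F) Hp) (hρ : WeilGroup.IsContinuousRep ρ), ρ.IsIrreducible →
        (∀ w, Module.End.IsSemisimple (ρ w)) → ∀ d : ℕ,
          finrank ℂ (homWDIn (stringModel ρ hρ d) σ U) = finrank ℂ (homWDIn (stringModel ρ hρ d) σ' U')) →
      (σ.ofSubrep U hU).IsEquivalent (σ'.ofSubrep U' hU') := by
  intro m
  induction m using Nat.strong_induction_on with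
  | _ m ih =>
    intro U U' hU hU' hm HK
    by_cases hU0 : U = ⊥
    · -- `U = 0` forces `U' = 0`
      subst hU0
      have hU'0 : U' = ⊥ := by
        by_contra hne
        obtain ⟨H', e', C', h', hS'U', -, -, -, -⟩ := exists_isStringHead_summand hσ' hU' hne
        haveI : Nontrivial H' := Submodule.nontrivial_iff_ne_bot.mpr h'.irreducible.1
        set ρ' := σ'.ρ.subrepresentation H' h'.irreducible.2.1
        have hρ' : WeilGroup.IsContinuousRep ρ' := isContinuousRep_subrepresentation σ'.isContinuous H' _
        have h1 := HK H' ρ' hρ' h'.irreducible.isIrreducible_subrepresentation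
          (fun w => isSemisimple_subrepresentation H' _ (hσ' w)) e'
        rw [K_bot] at h1
        have h2 : finrank ℂ (homWDIn (stringModel ρ' hρ' e') σ' (stringSpan σ' H' e')) = 1 :=
          (K_stringSpan ρ' hρ' h'.irreducible.isIrreducible_subrepresentation e' h').1
            ⟨0, h'.pos, isoTw_zero_refl ρ', by omega⟩
        have h3 := K_mono ρ' hρ' e' σ' hS'U'
        omega
      subst hU'0
      exact isEquivalent_ofSubrep_bot σ σ' hU hU'
    · -- peel off a string summand of `U`
      obtain ⟨H, e, C, h, hSU, hC, hCU, hSC, hdisj⟩ := exists_isStringHead_summand hσ hU hU0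
      have hS := isSubrep_stringSpan h.irreducible.2.1 h.le_ker
      haveI : Nontrivial H := Submodule.nontrivial_iff_ne_bot.mpr h.irreducible.1
      set ρH := σ.ρ.subrepresentation H h.irreducible.2.1 with hρHdef
      have hρH : WeilGroup.IsContinuousRep ρH := isContinuousRep_subrepresentation σ.isContinuous H _
      have hirrH : ρH.IsIrreducible := h.irreducible.isIrreducible_subrepresentation
      have hssH : ∀ w, Module.End.IsSemisimple (ρH w) := fun w => isSemisimple_subrepresentation H _ (hσ w)
      have hirrH' : (twistRep ρH (-1)).IsIrreducible := isIrreducible_twistRep hirrH (-1)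
      have hssH' : ∀ w, Module.End.IsSemisimple (twistRep ρH (-1) w) := fun w => isSemisimple_twistRep (hssH w) (-1)
      have he : 1 ≤ e := h.pos
      -- the count of `(ρ_H, e)`-strings agrees and is `≥ 1` on `U`
      have hcU : ((Module.finrank ℂ (homWDIn (stringModel (ρH) (hρH) e) (σ) U) : ℤ) - (Module.finrank ℂ (homWDIn (stringModel (ρH) (hρH) (e - 1)) (σ) U) : ℤ) -
      ((Module.finrank ℂ (homWDIn (stringModel (twistRep (ρH) (-1)) (isContinuousRep_twistRep (hρH) (-1)) (e + 1)) (σ) U) : ℤ) -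
        (Module.finrank ℂ (homWDIn (stringModel (twistRep (ρH) (-1)) (isContinuousRep_twistRep (hρH) (-1)) e) (σ) U) : ℤ))) = ((Module.finrank ℂ (homWDIn (stringModel (ρH) (hρH) e) (σ') U') : ℤ) - (Module.finrank ℂ (homWDIn (stringModel (ρH) (hρH) (e - 1)) (σ') U') : ℤ) -
      ((Module.finrank ℂ (homWDIn (stringModel (twistRep (ρH) (-1)) (isContinuousRep_twistRep (hρH) (-1)) (e + 1)) (σ') U') : ℤ) -
        (Module.finrank ℂ (homWDIn (stringModel (twistRep (ρH) (-1)) (isContinuousRep_twistRep (hρH) (-1)) e) (σ') U') : ℤ))) := by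
        rw [HK H ρH hρH hirrH hssH e, HK H ρH hρH hirrH hssH (e - 1),
          HK H (twistRep ρH (-1)) _ hirrH' hssH' (e + 1), HK H (twistRep ρH (-1)) _ hirrH' hssH' e]
      have hcS : ((Module.finrank ℂ (homWDIn (stringModel (ρH) (hρH) e) (σ) (stringSpan σ H e)) : ℤ) - (Module.finrank ℂ (homWDIn (stringModel (ρH) (hρH) (e - 1)) (σ) (stringSpan σ H e)) : ℤ) -
      ((Module.finrank ℂ (homWDIn (stringModel (twistRep (ρH) (-1)) (isContinuousRep_twistRep (hρH) (-1)) (e + 1)) (σ) (stringSpan σ H e)) : ℤ) -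
        (Module.finrank ℂ (homWDIn (stringModel (twistRep (ρH) (-1)) (isContinuousRep_twistRep (hρH) (-1)) e) (σ) (stringSpan σ H e)) : ℤ))) = 1 :=
        (c_stringSpan ρH hρH hirrH he h).1 ⟨isoTw_zero_refl ρH, rfl⟩
      have hcpos : ((Module.finrank ℂ (homWDIn (stringModel (ρH) (hρH) e) (σ') U') : ℤ) - (Module.finrank ℂ (homWDIn (stringModel (ρH) (hρH) (e - 1)) (σ') U') : ℤ) -
      ((Module.finrank ℂ (homWDIn (stringModel (twistRep (ρH) (-1)) (isContinuousRep_twistRep (hρH) (-1)) (e + 1)) (σ') U') : ℤ) -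
        (Module.finrank ℂ (homWDIn (stringModel (twistRep (ρH) (-1)) (isContinuousRep_twistRep (hρH) (-1)) e) (σ') U') : ℤ))) ≠ 0 := by
        rw [← hcU, ← hSC, c_sup ρH hρH e hS hC hdisj, hcS]
        have := c_nonneg hσ ρH hρH hirrH he _ C rfl hC
        omega
      -- a matching string summand of `U'`
      obtain ⟨H', C', h', hiso', hC', hC'U', hS'U', hSC', hdisj'⟩ :=
        exists_string_of_c_ne_zero hσ' ρH hρH hirrH he _ U' rfl hU' hcpos
      have hS' := isSubrep_stringSpan h'.irreducible.2.1 h'.le_ker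
      -- counts of a single string agree
      have hKS : ∀ (Hp : Type) [AddCommGroup Hp] [Module ℂ Hp] [FiniteDimensional ℂ Hp] [Nontrivial Hp]
          (ρ : Representation ℂ (WeilGroup F) Hp) (hρ : WeilGroup.IsContinuousRep ρ), ρ.IsIrreducible → ∀ d : ℕ,
          finrank ℂ (homWDIn (stringModel ρ hρ d) σ (stringSpan σ H e)) =
            finrank ℂ (homWDIn (stringModel ρ hρ d) σ' (stringSpan σ' H' e)) := by
        intro Hp _ _ _ _ ρ hρ hirr d
        classical
        have hiff : (∃ i : ℕ, i < e ∧ IsoTw ρH (i : ℤ) ρ ∧ e ≤ d + i) ↔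
            ∃ i : ℕ, i < e ∧ IsoTw (σ'.ρ.subrepresentation H' h'.irreducible.2.1) (i : ℤ) ρ ∧ e ≤ d + i := by
          simp only [isoTw_congr_left hiso' ρ]
        by_cases hc : ∃ i : ℕ, i < e ∧ IsoTw ρH (i : ℤ) ρ ∧ e ≤ d + i
        · rw [(K_stringSpan ρ hρ hirr d h).1 hc, (K_stringSpan ρ hρ hirr d h').1 (hiff.mp hc)]
        · rw [(K_stringSpan ρ hρ hirr d h).2 hc, (K_stringSpan ρ hρ hirr d h').2 (fun h2 => hc (hiff.mpr h2))]
      -- induction on the complements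
      have hS0 : stringSpan σ H e ≠ ⊥ := fun h0 => h.irreducible.1 (by
        rw [eq_bot_iff, ← h0]
        obtain ⟨e₀, he₀⟩ : ∃ e₀, e = e₀ + 1 := ⟨e - 1, by omega⟩
        rw [he₀]; exact le_stringSpan_succ σ H e₀)
      have hCm : finrank ℂ C < m := by
        have := finrank_sup_of_disjoint hdisj
        rw [hSC, hm] at this
        have : 0 < finrank ℂ ↥(stringSpan σ H e) := finrank_pos_iff.mpr (Submodule.nontrivial_iff_ne_bot.mpr hS0)
        omega
      have hKC : ∀ (Hp : Type) [AddCommGroup Hp] [Module ℂ Hp] [FiniteDimensional ℂ Hp] [Nontrivial Hp]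
          (ρ : Representation ℂ (WeilGroup F) Hp) (hρ : WeilGroup.IsContinuousRep ρ), ρ.IsIrreducible →
          (∀ w, Module.End.IsSemisimple (ρ w)) → ∀ d : ℕ,
          finrank ℂ (homWDIn (stringModel ρ hρ d) σ C) = finrank ℂ (homWDIn (stringModel ρ hρ d) σ' C') := by
        intro Hp _ _ _ _ ρ hρ hirr hss d
        have h1 := HK Hp ρ hρ hirr hss d
        rw [← hSC, ← hSC', K_sup ρ hρ d σ hS hC hdisj, K_sup ρ hρ d σ' hS' hC' hdisj', hKS Hp ρ hρ hirr d] at h1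
        omega
      have hCC' := ih _ hCm C C' hC hC' rfl hKC
      -- glue
      have hSS' : (σ.ofSubrep (stringSpan σ H e) hS).IsEquivalent (σ'.ofSubrep (stringSpan σ' H' e) hS') :=
        stub_isEquivalent_ofSubrep_stringSpan F V V' σ σ' H H' e h h' (nonempty_equiv_of_isoTw_zero hiso')
      have hglue := stub_isEquivalent_ofSubrep_sup F V V' σ σ' (stringSpan σ H e) C (stringSpan σ' H' e) C'
        hS hC hS' hC' (isSubrep_sup hS hC) (isSubrep_sup hS' hC') hdisj hdisj' hSS' hCC'
      exact ((isEquivalent_ofSubrep_of_eq σ hU (isSubrep_sup hS hC) hSC.symm).trans hglue).trans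
        (isEquivalent_ofSubrep_of_eq σ' (isSubrep_sup hS' hC') hU' hSC')

end Reconstruction

/-! ## Structure of (in)decomposable Frobenius-semisimple representations -/

section Structure

variable {V : Type} [AddCommGroup V] [Module ℂ V] [FiniteDimensional ℂ V]

omit [FiniteDimensional ℂ V] in
/-- A string over a string head is non-zero. [folklore] -/
theorem stringSpan_ne_bot {σ : WeilDeligneRep F ℂ V} {H : Submodule ℂ V} {e : ℕ} (h : IsStringHead σ H e) :
    stringSpan σ H e ≠ ⊥ := fun h0 => h.irreducible.1 (by
  rw [eq_bot_iff, ← h0]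
  obtain ⟨e₀, he₀⟩ : ∃ e₀, e = e₀ + 1 := ⟨e - 1, by have := h.pos; omega⟩
  rw [he₀]; exact le_stringSpan_succ σ H e₀)

/-- **An indecomposable Frobenius-semisimple representation is a single string.**
[cite: TateCorvallis1979, (4.1.5)] -/
theorem exists_string_eq_top_of_isIndecomposable {σ : WeilDeligneRep F ℂ V} (hσ : σ.IsFrobSemisimple)
    (hind : σ.IsIndecomposable) :
    ∃ (H : Submodule ℂ V) (e : ℕ) (_ : IsStringHead σ H e), stringSpan σ H e = ⊤ := by
  haveI := hind.1
  have htop : σ.IsSubrep ⊤ := ⟨fun _ _ _ => trivial, fun _ _ => trivial⟩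
  obtain ⟨H, e, C, h, -, hC, -, hSC, hdisj⟩ := exists_isStringHead_summand hσ htop top_ne_bot
  have hS := isSubrep_stringSpan h.irreducible.2.1 h.le_ker
  rcases hind.2 _ _ hS hC ⟨hdisj, codisjoint_iff.mpr hSC⟩ with h0 | h0
  · exact absurd h0 (stringSpan_ne_bot h)
  · exact ⟨H, e, h, by rw [← hSC, h0, sup_bot_eq]⟩

omit [FiniteDimensional ℂ V] in
/-- A single string of length `1` is irreducible; hence a non-irreducible single string has length `≥ 2`.
[cite: TateCorvallis1979, (4.1.5)] -/
theorem two_le_of_not_isIrreducible {σ : WeilDeligneRep F ℂ V} {H : Submodule ℂ V} {e : ℕ}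
    (h : IsStringHead σ H e) (htop : stringSpan σ H e = ⊤) (hirr : ¬ σ.IsIrreducible) : 2 ≤ e := by
  by_contra hlt
  have he1 : e = 1 := by have := h.pos; omega
  subst he1
  have hH : H = ⊤ := by rw [← htop, stringSpan_succ, stringSpan_zero, sup_bot_eq]
  obtain ⟨x, hx, hx0⟩ := Submodule.exists_mem_ne_zero_of_ne_bot h.irreducible.1
  haveI : Nontrivial V := nontrivial_of_ne x 0 hx0
  refine hirr ⟨inferInstance, fun p hp => ?_⟩
  rcases h.irreducible.2.2 p (hH ▸ le_top) hp.1 with h0 | h1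
  · exact Or.inl h0
  · exact Or.inr (h1.trans hH)

omit [FiniteDimensional ℂ V] in
/-- **An irreducible representation is a single string of length `1`** (`N = 0`).
[cite: TateCorvallis1979, (4.1.5)] -/
theorem isStringHead_top_of_isIrreducible {σ : WeilDeligneRep F ℂ V} (hirr : σ.IsIrreducible) :
    ∃ _ : IsStringHead σ ⊤ 1, stringSpan σ ⊤ 1 = ⊤ := by
  haveI := hirr.1
  have hN : σ.N = 0 := N_eq_zero_of_isIrreducible σ hirr
  refine ⟨⟨⟨top_ne_bot, fun _ _ _ => trivial, fun q _ hq => ?_⟩, Nat.one_pos, ?_, ?_⟩, ?_⟩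
  · exact hirr.2 q ⟨hq, fun v _ => by rw [Submodule.mem_comap, hN, LinearMap.zero_apply]; exact q.zero_mem⟩
  · intro v _
    rw [LinearMap.mem_ker, pow_one, hN, LinearMap.zero_apply]
  · rw [Nat.sub_self, ker_pow_N_zero]; exact disjoint_bot_right
  · rw [stringSpan_succ, stringSpan_zero, sup_bot_eq]

/-- A decomposable representation: two non-zero complementary sub-Weil–Deligne representations, each
of dimension `≤ dim V - 1`. [folklore] -/
theorem exists_decomposition_of_not_isIndecomposable {σ : WeilDeligneRep F ℂ V} [Nontrivial V]
    (h : ¬ σ.IsIndecomposable) :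
    ∃ A B : Submodule ℂ V, σ.IsSubrep A ∧ σ.IsSubrep B ∧ Disjoint A B ∧ A ⊔ B = ⊤ ∧ A ≠ ⊥ ∧ B ≠ ⊥ ∧
      finrank ℂ A + 1 ≤ finrank ℂ V ∧ finrank ℂ B + 1 ≤ finrank ℂ V := by
  unfold WeilDeligneRep.IsIndecomposable at h
  simp only [not_and, not_forall, not_or] at h
  obtain ⟨A, B, hA, hB, hc, hA0, hB0⟩ := h inferInstance
  have hdim : finrank ℂ A + finrank ℂ B = finrank ℂ V := by
    rw [← finrank_sup_of_disjoint hc.disjoint, codisjoint_iff.mp hc.codisjoint, finrank_top]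
  have hA1 : 0 < finrank ℂ A := finrank_pos_iff.mpr (Submodule.nontrivial_iff_ne_bot.mpr hA0)
  have hB1 : 0 < finrank ℂ B := finrank_pos_iff.mpr (Submodule.nontrivial_iff_ne_bot.mpr hB0)
  exact ⟨A, B, hA, hB, hc.disjoint, codisjoint_iff.mp hc.codisjoint, hA0, hB0, by omega, by omega⟩

end Structure

/-- **Registered sub-goal `stub_isEquivalent_ofSubrep_of_K_eq` (reconstruction from the counts).**
Sub-Weil–Deligne representations `U ≤ σ`, `U' ≤ σ'` of Frobenius-semisimple `σ, σ'` with the same counts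
`dim Hom_WD(ρ ⊗ Sp(d), σ; U) = dim Hom_WD(ρ ⊗ Sp(d), σ'; U')` against every standard string are isomorphic.
[cite: HenniartBSMF2002, Thm. 1.7 (a)] -/
theorem stub_isEquivalent_ofSubrep_of_K_eq : ∀ (F : Type) [Field F] [ValuativeRel F] [TopologicalSpace F] [IsNonarchimedeanLocalField F] (V : Type) [AddCommGroup V] [Module ℂ V] [FiniteDimensional ℂ V] (V' : Type) [AddCommGroup V'] [Module ℂ V'] [FiniteDimensional ℂ V'] (σ : WeilDeligneRep F ℂ V) (σ' : WeilDeligneRep F ℂ V'), σ.IsFrobSemisimple → σ'.IsFrobSemisimple → ∀ (U : Submodule ℂ V) (U' : Submodule ℂ V') (hU : σ.IsSubrep U) (hU' : σ'.IsSubrep U'), (∀ (Hp : Type) [AddCommGroup Hp] [Module ℂ Hp] [FiniteDimensional ℂ Hp] [Nontrivial Hp] (ρ : Representation ℂ (WeilGroup F) Hp) (hρ : WeilGroup.IsContinuousRep ρ), ρ.IsIrreducible → (∀ w : WeilGroup F, Module.End.IsSemisimple (ρ w)) → ∀ d : ℕ, Module.finrank ℂ ↥(homWDIn (stringModel ρ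 hρ d) σ U) = Module.finrank ℂ ↥(homWDIn (stringModel ρ hρ d) σ' U')) → (σ.ofSubrep U hU).IsEquivalent (σ'.ofSubrep U' hU') :=
  fun _ _ _ _ _ _ _ _ _ _ _ _ _ _ _ hσ hσ' U U' hU hU' HK => isEquivalent_ofSubrep_of_K_eq hσ hσ' _ U U' hU hU' rfl HK

end Summit.Langlands.Langlands.Theorems.ReciprocityUpToIrreducibilityR

end
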